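import Summits.NavierStokesRegularity.NavierStokesRegularity.Theorems.AxisymmetricExtremalityAxisymmetricKatoGlobalStubSeregin2020TypeIILemma22MoserEnergy
import Summits.NavierStokesRegularity.NavierStokesRegularity.Theorems.AxisymmetricExtremalityAxisymmetricKatoGlobalStubSeregin2020TypeIILemma22MoserAlgebra
import Summits.NavierStokesRegularity.NavierStokesRegularity.Theorems.AxisymmetricExtremalityAxisymmetricKatoGlobalStubSeregin2020TypeIILemma22ParabolicEmbedding
import Summits.NavierStokesRegularity.NavierStokesRegularity.Theorems.AxisymmetricExtremalityAxisymmetricKatoGlobalStubSeregin2020TypeIILemma22GradientMeasurability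
import HarnessLib

/-!
# Seregin 2020, Lemma 2.2 (after Nazarov–Uraltseva 2012), atom M1 (`lemma22_moserStep`): the
# parabolic embedding of `w = η^{1/2}(l-Φ)₊^{q/2}φ³` into `L^{10/3}_{t,x}`

Helper toward the registered stub `lemma22_moserStep` of stmt-NavierStokesRegularity-15453 (crux
`AxisymmetricKatoGlobal`; Seregin 2020 Lemma 2.2 ⇐ N–U 2012 Lemma 3.1). From the energy bounds of
`…Lemma22MoserEnergy` (`moser_energy_bounds`: slices and dissipation `≤ E = E₀ + DR`), the
embedding `𝒱 ⊂ L^{10/3}_{t,x}` (`parabolicEmbedding_of_contDiff`, `r = l = 10/3`, `κ = 1`) gives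
`T = ∫∫ w^{10/3} ≤ 3 C_S² E^{5/3}`; the drift majorant is `∫∫ 2|U| w^{5/3} g ≤ 2‖U‖₃ T^{1/2} ‖g‖₆`
(Hölder `(3,2,6)`, `g⁶ = 729 η (l-Φ)₊^q ‖Dφ‖⁶`); with `y = T^{1/10}` this reads `y⁶ ≤ a + b y⁵` and
is absorbed (`pow_six_le_of_le_add_mul_pow_five`). Result (`moser_reverse_holder_core`):

  `∫∫_{]t₁,t₀[×ℝ³} w^{10/3} ≤ (2C₁E₀ + 2^{12}·729·C₁⁶ L_φ⁶ ‖U‖_{L³(Q₁)}⁶ I₁)^{5/3}`,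
  `C₁ = (3 C_S²)^{3/5}`, `E₀ = (36 L_φ² + B_η) I₁`, `I₁ = ∫∫_{Q₁} (l-Φ)₊^q`, `Q₁ = ]t₁,t₀[ × B̄(0,ρ₁)`.

## References

* A. I. Nazarov, N. N. Uraltseva, St. Petersburg Math. J. 23 (2012) 93–115 = arXiv:1011.1888,
  §3, Lemma 3.1, (3.3)–(3.6), Remarks 5, 6, 9. [NazarovUraltseva2012]
* G. Seregin, Anal. Math. Phys. 10 (2020), Paper 46 = arXiv:2006.04140, Lemma 2.2. [Seregin2020]
-/

-- the problem directory repeats the summit name (D-0017); core's `dupNamespace` linter fires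
set_option linter.dupNamespace false

noncomputable section

open MeasureTheory Set Function Filter Topology Metric
open scoped NNReal ENNReal RealInnerProductSpace

namespace Summit.NavierStokesRegularity.NavierStokesRegularity.Theorems.AxisymmetricKatoGlobal.EulerScaling

open Literature.Analysis.FluidPDE Literature.Analysis.FluidPDE.LeiZhang2011

/-- `ofReal x = 2 · ofReal (x/2)`. [folklore] -/
theorem ofReal_eq_two_mul_ofReal_half (x : ℝ) :
    ENNReal.ofReal x = 2 * ENNReal.ofReal (1 / 2 * x) := by
  rw [← ENNReal.ofReal_ofNat 2, ← ENNReal.ofReal_mul (by norm_num)]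
  congr 1; ring

/-- Powers of `y = T^{1/10}` in `ℝ≥0∞`: `y⁶ = T^{3/5}`, `y⁵ = T^{1/2}`, `(y⁶)^{5/3} = T`. [folklore] -/
theorem rpow_tenth_powers (T : ℝ≥0∞) :
    (T ^ ((1 : ℝ) / 10)) ^ (6 : ℕ) = T ^ ((3 : ℝ) / 5) ∧
    (T ^ ((1 : ℝ) / 10)) ^ (5 : ℕ) = T ^ ((1 : ℝ) / 2) ∧
    ((T ^ ((1 : ℝ) / 10)) ^ (6 : ℕ)) ^ ((5 : ℝ) / 3) = T := by
  refine ⟨?_, ?_, ?_⟩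
  · rw [← ENNReal.rpow_natCast, ← ENNReal.rpow_mul]; norm_num
  · rw [← ENNReal.rpow_natCast, ← ENNReal.rpow_mul]; norm_num
  · rw [← ENNReal.rpow_natCast, ← ENNReal.rpow_mul, ← ENNReal.rpow_mul]; norm_num

/-- **The parabolic embedding of `w = η^{1/2}(l-Φ)₊^{q/2}φ³` (N–U (3.5) with `r = l = 10/3`).**
Data as in `moser_energy_bounds` plus the `C¹` slices for a.e. `t ∈ ]-R²,0[`; conclusion:
`T = ∫∫_{]t₁,t₀[×ℝ³} w^{10/3}` is finite and `T ≤ 3 C_S² E^{5/3}`,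
`E = (36 L_φ² + B_η) I₁ + ∫∫_{Q₁} 6 η (l-Φ)₊^q φ⁵ |U| ‖Dφ‖` (`parabolicEmbedding_of_contDiff` with the
slice bounds of `moser_energy_bounds`; the slice gradient is `∇w = η^{1/2}(φ³∇v + v∇φ³)`,
`‖∇w‖² ≤ η H''(Φ)‖∇Φ‖²Θ² + 18 η (l-Φ)₊^q ‖Dφ‖²`). [cite: NazarovUraltseva2012, proof of Lemma 3.1, (3.5) with r = l = 2(n+2)/n] -/
theorem moser_embedding_estimate
    (Φ : ℝ → EuclideanSpace ℝ (Fin 3) → ℝ)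
    (U : ℝ → EuclideanSpace ℝ (Fin 3) → EuclideanSpace ℝ (Fin 3)) (k R : ℝ)
    (hΦm : Measurable (uncurry Φ)) (hΦ0 : ∀ t x, 0 ≤ Φ t x)
    (hC1 : ∀ᵐ t : ℝ, t ∈ Ioo (-R ^ 2) 0 → ContDiff ℝ 1 (Φ t))
    (hU : AEStronglyMeasurable (uncurry U) volume)
    (hEC : ∀ (H : ℝ → ℝ), ContDiff ℝ 2 H → (∀ v, deriv H v ≤ 0) → (∀ v, 0 ≤ H v) →
      (∀ v, 0 ≤ deriv (deriv H) v) → (∀ v, deriv H v ^ 2 ≤ 2 * H v * deriv (deriv H) v) →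
      (∀ v, k ≤ v → H v = 0) →
      ∀ (Θ : EuclideanSpace ℝ (Fin 3) → ℝ), ContDiff ℝ 1 Θ → HasCompactSupport Θ →
        tsupport Θ ⊆ ball (0 : EuclideanSpace ℝ (Fin 3)) (2 * R) →
      ∀ (η : ℝ → ℝ), ContDiff ℝ 1 η → (∀ s, 0 ≤ η s) →
      ∀ (t₁ t₂ : ℝ), -R ^ 2 < t₁ → t₁ ≤ t₂ → t₂ < 0 →
        ENNReal.ofReal (η t₂ * ∫ x, H (Φ t₂ x) * Θ x ^ 2) +
          ∫⁻ z in Icc t₁ t₂ ×ˢ (univ : Set (EuclideanSpace ℝ (Fin 3))), ENNReal.ofReal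
            (1 / 2 * η z.1 * (deriv (deriv H) (Φ z.1 z.2) * ‖gradient (Φ z.1) z.2‖ ^ 2 *
              Θ z.2 ^ 2))
        ≤ ENNReal.ofReal (η t₁ * (∫ x, H (Φ t₁ x) * Θ x ^ 2) +
            (4 * ∫ z in Icc t₁ t₂ ×ˢ (univ : Set (EuclideanSpace ℝ (Fin 3))),
              η z.1 * (H (Φ z.1 z.2) * ‖gradient Θ z.2‖ ^ 2)) +
            (∫ z in Icc t₁ t₂ ×ˢ (univ : Set (EuclideanSpace ℝ (Fin 3))),
              η z.1 * (H (Φ z.1 z.2) * inner ℝ (U z.1 z.2) (gradient (fun y => Θ y ^ 2) z.2))) +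
            (∫ z in Icc t₁ t₂ ×ˢ (univ : Set (EuclideanSpace ℝ (Fin 3))),
              η z.1 * (2 / cylRadius z.2 *
                (H (Φ z.1 z.2) * fderiv ℝ (fun y => Θ y ^ 2) z.2 (eR z.2)))) +
            (∫ z in Icc t₁ t₂ ×ˢ (univ : Set (EuclideanSpace ℝ (Fin 3))),
              |deriv η z.1| * (H (Φ z.1 z.2) * Θ z.2 ^ 2))))
    {ρ₂ ρ₁ t₁ t₀ l q Lφ Bη : ℝ} (hρ₂ : 0 < ρ₂) (hρ₁ : ρ₂ < ρ₁) (hρ₁R : ρ₁ < 2 * R)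
    (ht₁ : -R ^ 2 < t₁) (ht : t₁ < t₀) (ht₀ : t₀ ≤ 0) (hl : 0 < l) (hlk : l ≤ k) (hq : 2 < q)
    {φ : EuclideanSpace ℝ (Fin 3) → ℝ} (hφdef : φ = radialCutoff ρ₂ ρ₁)
    (hLφ : ∀ x, ‖fderiv ℝ φ x‖ ≤ Lφ)
    {η : ℝ → ℝ} (hη : ContDiff ℝ 1 η) (hη01 : ∀ s, 0 ≤ η s ∧ η s ≤ 1) (hBη0 : 0 ≤ Bη)
    (hBη : ∀ s, |deriv η s| ≤ Bη)
    (hinit : η t₁ * (∫ x, max (l - Φ t₁ x) 0 ^ q * (φ x ^ 3) ^ 2) = 0) :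
    (∫⁻ z in Ioo t₁ t₀ ×ˢ (univ : Set (EuclideanSpace ℝ (Fin 3))),
        ENNReal.ofReal ((η z.1 ^ ((1 : ℝ) / 2) * max (l - Φ z.1 z.2) 0 ^ (q / 2) * φ z.2 ^ 3) ^
          ((10 : ℝ) / 3)) ≠ ∞) ∧
    ∫⁻ z in Ioo t₁ t₀ ×ˢ (univ : Set (EuclideanSpace ℝ (Fin 3))),
        ENNReal.ofReal ((η z.1 ^ ((1 : ℝ) / 2) * max (l - Φ z.1 z.2) 0 ^ (q / 2) * φ z.2 ^ 3) ^
          ((10 : ℝ) / 3)) ≤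
      3 * (SNormLESNormFDerivOfEqConst ℝ (volume : Measure (EuclideanSpace ℝ (Fin 3))) 2 : ℝ≥0∞) ^ 2 *
        (ENNReal.ofReal (36 * Lφ ^ 2 + Bη) *
            (∫⁻ z in Ioo t₁ t₀ ×ˢ closedBall (0 : EuclideanSpace ℝ (Fin 3)) ρ₁,
              ENNReal.ofReal (max (l - Φ z.1 z.2) 0 ^ q)) +
          ∫⁻ z in Ioo t₁ t₀ ×ˢ closedBall (0 : EuclideanSpace ℝ (Fin 3)) ρ₁,
            ENNReal.ofReal (6 * (η z.1 * max (l - Φ z.1 z.2) 0 ^ q) * φ z.2 ^ 5 *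
              ‖U z.1 z.2‖ * ‖fderiv ℝ φ z.2‖)) ^ ((5 : ℝ) / 3) := by
  ----------------------------------------------------------------
  -- notation
  ----------------------------------------------------------------
  set CS : ℝ≥0∞ := (SNormLESNormFDerivOfEqConst ℝ (volume : Measure (EuclideanSpace ℝ (Fin 3))) 2
    : ℝ≥0∞) with hCS
  set C₁ : ℝ≥0∞ := (3 * CS ^ 2) ^ ((3 : ℝ) / 5) with hC₁
  set K : Set (EuclideanSpace ℝ (Fin 3)) := closedBall (0 : EuclideanSpace ℝ (Fin 3)) ρ₁ with hK
  have hKm : MeasurableSet K := measurableSet_closedBall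
  set Q₁ : Set (ℝ × EuclideanSpace ℝ (Fin 3)) := Ioo t₁ t₀ ×ˢ K with hQ₁
  have hQ₁m : MeasurableSet Q₁ := measurableSet_Ioo.prod hKm
  set Qu : Set (ℝ × EuclideanSpace ℝ (Fin 3)) := Ioo t₁ t₀ ×ˢ (univ : Set (EuclideanSpace ℝ (Fin 3)))
    with hQu
  set V : ℝ × EuclideanSpace ℝ (Fin 3) → ℝ := fun z => max (l - Φ z.1 z.2) 0 with hV
  have hV0 : ∀ z, 0 ≤ V z := fun z => le_max_right _ _
  have hVm : Measurable V := (measurable_const.sub hΦm).max measurable_const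
  have hVl : ∀ z, V z ≤ l := fun z => max_le (by linarith [hΦ0 z.1 z.2]) hl.le
  set w : ℝ × EuclideanSpace ℝ (Fin 3) → ℝ := fun z =>
    η z.1 ^ ((1 : ℝ) / 2) * V z ^ (q / 2) * φ z.2 ^ 3 with hw
  set g : ℝ × EuclideanSpace ℝ (Fin 3) → ℝ := fun z =>
    3 * (η z.1 ^ ((1 : ℝ) / 6) * V z ^ (q / 6)) * ‖fderiv ℝ φ z.2‖ with hg
  set I₁ : ℝ≥0∞ := ∫⁻ z in Q₁, ENNReal.ofReal (V z ^ q) with hI₁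
  set U₃ : ℝ≥0∞ := ∫⁻ z in Q₁, ‖U z.1 z.2‖ₑ ^ (3 : ℕ) with hU₃
  set E₀ : ℝ≥0∞ := ENNReal.ofReal (36 * Lφ ^ 2 + Bη) * I₁ with hE₀
  set DR : ℝ≥0∞ := ∫⁻ z in Q₁, ENNReal.ofReal (6 * (η z.1 * V z ^ q) * φ z.2 ^ 5 *
    ‖U z.1 z.2‖ * ‖fderiv ℝ φ z.2‖) with hDR
  set E : ℝ≥0∞ := E₀ + DR with hE
  set T : ℝ≥0∞ := ∫⁻ z in Qu, ENNReal.ofReal (w z ^ ((10 : ℝ) / 3)) with hT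
  set G : ℝ≥0∞ := (ENNReal.ofReal (729 * Lφ ^ 6) * I₁) ^ ((1 : ℝ) / 6) with hG
  -- cut-off facts
  obtain ⟨hΘ1, hΘc, hΘK, hφ01, -, -, -, -⟩ := moserTheta_props hρ₂.le hρ₁ hφdef
  have hφs : ContDiff ℝ 1 φ := by rw [hφdef]; exact radialCutoff_contDiff ρ₂ ρ₁
  have hφc : Continuous φ := hφs.continuous
  have hφK : ∀ x, x ∉ K → φ x = 0 := fun x hx => by
    rw [hφdef]
    exact radialCutoff_eq_zero hρ₂.le hρ₁ (le_of_lt (by simpa [hK, mem_closedBall_zero_iff] using hx))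
  have hη0 : ∀ s, 0 ≤ η s := fun s => (hη01 s).1
  have hη1 : ∀ s, η s ≤ 1 := fun s => (hη01 s).2
  have hw0 : ∀ z, 0 ≤ w z := fun z =>
    mul_nonneg (mul_nonneg (Real.rpow_nonneg (hη0 _) _) (Real.rpow_nonneg (hV0 z) _))
      (pow_nonneg (hφ01 _).1 3)
  have hg0 : ∀ z, 0 ≤ g z := fun z => by
    simp only [hg]
    exact mul_nonneg (mul_nonneg (by norm_num) (mul_nonneg (Real.rpow_nonneg (hη0 _) _)
      (Real.rpow_nonneg (hV0 z) _))) (norm_nonneg _)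
  -- measurability
  have hηm : Measurable η := hη.continuous.measurable
  have hwm : Measurable w :=
    (((hηm.comp measurable_fst).pow_const _).mul (hVm.pow_const _)).mul
      ((hφc.measurable.comp measurable_snd).pow_const _)
  have hDφm : Measurable fun z : ℝ × EuclideanSpace ℝ (Fin 3) => ‖fderiv ℝ φ z.2‖ :=
    ((hφs.continuous_fderiv one_ne_zero).norm.measurable.comp measurable_snd)
  have hgm : Measurable g :=
    (measurable_const.mul (((hηm.comp measurable_fst).pow_const _).mul (hVm.pow_const _))).mul hDφm
  have hUm : AEStronglyMeasurable (fun z : ℝ × EuclideanSpace ℝ (Fin 3) => U z.1 z.2) volume := hU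
  ----------------------------------------------------------------
  -- Step 0: the energy bounds
  ----------------------------------------------------------------
  obtain ⟨hslice, hdiss⟩ := moser_energy_bounds Φ U k R hΦm hΦ0 hEC hρ₂ hρ₁ hρ₁R ht₁ ht ht₀ hl hlk
    hq hφdef hLφ hη hη01 hBη0 hBη hinit
  ----------------------------------------------------------------
  -- Step 1: `T < ∞` (`w ≤ l^{q/2}` is supported in `Q₁`, a set of finite measure)
  ----------------------------------------------------------------
  have hwle : ∀ z, w z ≤ l ^ (q / 2) := fun z => by
    have h1 : η z.1 ^ ((1 : ℝ) / 2) ≤ 1 := Real.rpow_le_one (hη0 _) (hη1 _) (by norm_num)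
    have h2 : V z ^ (q / 2) ≤ l ^ (q / 2) :=
      Real.rpow_le_rpow (hV0 z) (hVl z) (by linarith)
    have h3 : φ z.2 ^ 3 ≤ 1 := pow_le_one₀ (hφ01 _).1 (hφ01 _).2
    have hab : η z.1 ^ ((1 : ℝ) / 2) * V z ^ (q / 2) ≤ 1 * l ^ (q / 2) :=
      mul_le_mul h1 h2 (Real.rpow_nonneg (hV0 z) _) zero_le_one
    calc w z = η z.1 ^ ((1 : ℝ) / 2) * V z ^ (q / 2) * φ z.2 ^ 3 := rfl
      _ ≤ 1 * l ^ (q / 2) * 1 := mul_le_mul hab h3 (pow_nonneg (hφ01 _).1 3) (by positivity)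
      _ = l ^ (q / 2) := by ring
  have hwK : ∀ z : ℝ × EuclideanSpace ℝ (Fin 3), z.2 ∉ K → w z = 0 := fun z hz => by
    simp only [hw, hφK z.2 hz]; ring
  have hTfin : T ≠ ∞ := by
    have hvol : volume Q₁ ≠ ∞ := by
      rw [hQ₁, Measure.volume_eq_prod, Measure.prod_prod]
      exact ENNReal.mul_ne_top (by rw [Real.volume_Ioo]; exact ENNReal.ofReal_ne_top)
        measure_closedBall_lt_top.ne
    have hle : T ≤ ∫⁻ z in Qu, Q₁.indicator (fun _ => ENNReal.ofReal ((l ^ (q / 2)) ^ ((10 : ℝ) / 3))) z := by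
      refine setLIntegral_mono' (measurableSet_Ioo.prod MeasurableSet.univ) fun z hz => ?_
      by_cases hz2 : z.2 ∈ K
      · rw [indicator_of_mem (show z ∈ Q₁ from ⟨hz.1, hz2⟩)]
        exact ENNReal.ofReal_le_ofReal (Real.rpow_le_rpow (hw0 z) (hwle z) (by norm_num))
      · rw [hwK z hz2, Real.zero_rpow (by norm_num), ENNReal.ofReal_zero]; exact bot_le
    refine ne_top_of_le_ne_top ?_ hle
    rw [lintegral_indicator hQ₁m, setLIntegral_const]
    refine ENNReal.mul_ne_top ENNReal.ofReal_ne_top ?_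
    exact ne_top_of_le_ne_top hvol (by
      rw [Measure.restrict_apply hQ₁m]; exact measure_mono inter_subset_left)
  ----------------------------------------------------------------
  -- Step 2: the embedding `T ≤ 3 C_S² E^{5/3}`
  ----------------------------------------------------------------
  set ν : Measure ℝ := volume.restrict (Ioo t₁ t₀) with hν
  set gs : ℝ → EuclideanSpace ℝ (Fin 3) → ℝ := fun s x => w (s, x) with hgs
  -- a.e. `s`: the slice of `Φ` is `C¹`
  have hC1ν : ∀ᵐ s ∂ν, ContDiff ℝ 1 (Φ s) := by
    rw [hν, ae_restrict_iff' measurableSet_Ioo]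
    filter_upwards [hC1] with s hs hsI
    exact hs ⟨ht₁.trans hsI.1, hsI.2.trans_le ht₀⟩
  have hgsC1 : ∀ᵐ s ∂ν, ContDiff ℝ 1 (gs s) := by
    filter_upwards [hC1ν] with s hs
    exact (sq_norm_fderiv_wSlice_le hs hφs hφ01 hq l (hη0 s)).1
  -- slice `L²` finiteness
  have hgs2 : ∀ᵐ s ∂ν, eLpNorm (gs s) 2 (volume : Measure (EuclideanSpace ℝ (Fin 3))) < ∞ := by
    filter_upwards [hgsC1] with s hs
    have hcs : HasCompactSupport (gs s) := by
      refine HasCompactSupport.of_support_subset_isCompact (isCompact_closedBall (0 : EuclideanSpace ℝ (Fin 3)) ρ₁) ?_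
      intro x hx
      by_contra hxK
      exact hx (hwK (s, x) hxK)
    exact (hs.continuous.memLp_of_hasCompactSupport hcs).eLpNorm_lt_top
  -- slice `L²` bound `≤ E`
  have hM : ∀ᵐ s ∂ν, ∫⁻ x, ‖gs s x‖ₑ ^ 2 ≤ E := by
    rw [hν, ae_restrict_iff' measurableSet_Ioo]
    refine ae_of_all _ fun s hsI => ?_
    have h := hslice s hsI
    have e : (fun x => ‖gs s x‖ₑ ^ 2) =
        fun x => ENNReal.ofReal (η s * max (l - Φ s x) 0 ^ q * (φ x ^ 3) ^ 2) := by
      funext x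
      rw [Real.enorm_eq_ofReal (hw0 (s, x)), ← ENNReal.ofReal_pow (hw0 (s, x))]
      congr 1
      show (η s ^ ((1 : ℝ) / 2) * V (s, x) ^ (q / 2) * φ x ^ 3) ^ 2 = _
      rw [sq_w_rpow (hη0 s) (hV0 (s, x))]
      ring
    rw [e]; exact h
  -- slice gradient bound: `W s = ∫ ‖D(gs s)‖²` itself; its integral is controlled by the dissipation
  set W : ℝ → ℝ≥0∞ := fun s => ∫⁻ x, ‖fderiv ℝ (gs s) x‖ₑ ^ 2 with hW
  have hDw_meas : AEStronglyMeasurable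
      (fun z : ℝ × EuclideanSpace ℝ (Fin 3) => fderiv ℝ (gs z.1) z.2) (ν.prod volume) := by
    have hm : Measurable (uncurry gs) := by
      have : uncurry gs = w := by funext z; rfl
      rw [this]; exact hwm
    exact aestronglyMeasurable_fderiv_slice_of_ae_differentiable hm ν volume
      (hgsC1.mono fun s hs => hs.differentiable one_ne_zero)
  have hWm : AEMeasurable W ν := (hDw_meas.enorm.pow_const _).lintegral_prod_right'
  have hWle : ∀ᵐ s ∂ν, ∫⁻ x, ‖fderiv ℝ (gs s) x‖ₑ ^ 2 ≤ W s := ae_of_all _ fun s => le_rfl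
  -- `∫ W ≤ 2·(dissipation) + 18 L_φ² I₁ ≤ 3 E`
  have hWint : ∫⁻ s, W s ∂ν ≤ 3 * E := by
    -- pointwise a.e. bound on the product
    have hprod : ∫⁻ s, W s ∂ν = ∫⁻ z, ‖fderiv ℝ (gs z.1) z.2‖ₑ ^ 2 ∂(ν.prod volume) := by
      rw [lintegral_prod _ (hDw_meas.enorm.pow_const _)]
    have hνprod : ν.prod (volume : Measure (EuclideanSpace ℝ (Fin 3))) = volume.restrict Qu := by
      rw [hν, hQu, Measure.restrict_prod_eq_prod_univ, ← Measure.volume_eq_prod]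
    have hae : ∀ᵐ z ∂(volume.restrict Qu),
        ‖fderiv ℝ (gs z.1) z.2‖ₑ ^ 2 ≤
          ENNReal.ofReal (η z.1 * (deriv (deriv fun τ : ℝ => max (l - τ) 0 ^ q) (Φ z.1 z.2) *
            ‖gradient (Φ z.1) z.2‖ ^ 2 * (φ z.2 ^ 3) ^ 2)) +
          Q₁.indicator (fun z => ENNReal.ofReal (18 * Lφ ^ 2) * ENNReal.ofReal (V z ^ q)) z := by
      have hq' : Measure.QuasiMeasurePreserving (Prod.fst : ℝ × EuclideanSpace ℝ (Fin 3) → ℝ)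
          (volume.restrict Qu) ν := by
        rw [← hνprod]; exact Measure.quasiMeasurePreserving_fst
      have hmem : ∀ᵐ z ∂(volume.restrict Qu), z ∈ Qu :=
        ae_restrict_mem (measurableSet_Ioo.prod MeasurableSet.univ)
      filter_upwards [hq'.ae hC1ν, hmem] with z hz hzQu
      obtain ⟨-, hb⟩ := sq_norm_fderiv_wSlice_le hz hφs hφ01 hq l (hη0 z.1)
      have h1 := hb z.2
      have hA0 : 0 ≤ η z.1 * (deriv (deriv fun τ : ℝ => max (l - τ) 0 ^ q) (Φ z.1 z.2) *
          ‖gradient (Φ z.1) z.2‖ ^ 2 * (φ z.2 ^ 3) ^ 2) :=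
        mul_nonneg (hη0 _) (mul_nonneg (mul_nonneg
          (deriv_deriv_posPart_const_sub_rpow_nonneg hq l _) (sq_nonneg _)) (sq_nonneg _))
      rw [← ofReal_norm, ← ENNReal.ofReal_pow (norm_nonneg _)]
      by_cases hzK : z.2 ∈ K
      · rw [indicator_of_mem (show z ∈ Q₁ from ⟨hzQu.1, hzK⟩),
          ← ENNReal.ofReal_mul (by positivity), ← ENNReal.ofReal_add hA0
            (mul_nonneg (by positivity) (Real.rpow_nonneg (hV0 z) _))]
        refine ENNReal.ofReal_le_ofReal (h1.trans ?_)
        have : 18 * η z.1 * V z ^ q * ‖fderiv ℝ φ z.2‖ ^ 2 ≤ 18 * Lφ ^ 2 * V z ^ q := by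
          have hD : ‖fderiv ℝ φ z.2‖ ^ 2 ≤ Lφ ^ 2 := pow_le_pow_left₀ (norm_nonneg _) (hLφ _) 2
          have hVq : 0 ≤ V z ^ q := Real.rpow_nonneg (hV0 z) _
          calc 18 * η z.1 * V z ^ q * ‖fderiv ℝ φ z.2‖ ^ 2 ≤ 18 * 1 * V z ^ q * Lφ ^ 2 :=
                mul_le_mul (mul_le_mul_of_nonneg_right (by linarith [hη1 z.1]) hVq) hD (sq_nonneg _)
                  (by positivity)
            _ = 18 * Lφ ^ 2 * V z ^ q := by ring
        linarith
      · have hD0 : fderiv ℝ φ z.2 = 0 := by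
          have : z.2 ∉ tsupport φ := fun h => hzK (by
            rw [hφdef] at h; exact tsupport_radialCutoff_subset hρ₂.le hρ₁ h)
          exact fderiv_of_notMem_tsupport ℝ this
        rw [indicator_of_notMem (fun h : z ∈ Q₁ => hzK h.2), add_zero]
        refine ENNReal.ofReal_le_ofReal (h1.trans ?_)
        rw [hD0, norm_zero]
        linarith
    rw [hprod, hνprod]
    calc ∫⁻ z in Qu, ‖fderiv ℝ (gs z.1) z.2‖ₑ ^ 2
        ≤ ∫⁻ z in Qu, (ENNReal.ofReal (η z.1 * (deriv (deriv fun τ : ℝ => max (l - τ) 0 ^ q)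
            (Φ z.1 z.2) * ‖gradient (Φ z.1) z.2‖ ^ 2 * (φ z.2 ^ 3) ^ 2)) +
            Q₁.indicator (fun z => ENNReal.ofReal (18 * Lφ ^ 2) * ENNReal.ofReal (V z ^ q)) z) :=
          lintegral_mono_ae hae
      _ = (∫⁻ z in Qu, ENNReal.ofReal (η z.1 * (deriv (deriv fun τ : ℝ => max (l - τ) 0 ^ q)
            (Φ z.1 z.2) * ‖gradient (Φ z.1) z.2‖ ^ 2 * (φ z.2 ^ 3) ^ 2))) +
            ∫⁻ z in Qu, Q₁.indicator
              (fun z => ENNReal.ofReal (18 * Lφ ^ 2) * ENNReal.ofReal (V z ^ q)) z :=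
          lintegral_add_right' _
            ((((hVm.pow_const _).ennreal_ofReal.const_mul _).indicator hQ₁m).aemeasurable)
      _ ≤ 2 * E + ENNReal.ofReal (18 * Lφ ^ 2) * I₁ := by
          gcongr ?_ + ?_
          · -- twice the dissipation
            have e2 : (fun z : ℝ × EuclideanSpace ℝ (Fin 3) => ENNReal.ofReal (η z.1 *
                (deriv (deriv fun τ : ℝ => max (l - τ) 0 ^ q) (Φ z.1 z.2) *
                  ‖gradient (Φ z.1) z.2‖ ^ 2 * (φ z.2 ^ 3) ^ 2))) =
                fun z => 2 * ENNReal.ofReal (1 / 2 * η z.1 *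
                  (deriv (deriv fun τ : ℝ => max (l - τ) 0 ^ q) (Φ z.1 z.2) *
                    ‖gradient (Φ z.1) z.2‖ ^ 2 * (φ z.2 ^ 3) ^ 2)) := by
              funext z
              rw [ofReal_eq_two_mul_ofReal_half]
              congr 2; ring
            rw [e2, lintegral_const_mul' _ _ (by norm_num)]
            gcongr
          · -- the `|Dφ|²` term lives on `Q₁ ⊆ Qu`
            rw [lintegral_indicator hQ₁m, Measure.restrict_restrict hQ₁m,
              inter_eq_left.2 (prod_mono le_rfl (subset_univ _)),
              lintegral_const_mul' _ _ ENNReal.ofReal_ne_top]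
      _ ≤ 3 * E := by
          have h36 : ENNReal.ofReal (18 * Lφ ^ 2) * I₁ ≤ E := by
            calc ENNReal.ofReal (18 * Lφ ^ 2) * I₁ ≤ ENNReal.ofReal (36 * Lφ ^ 2 + Bη) * I₁ := by
                  gcongr; linarith [sq_nonneg Lφ]
              _ ≤ E := le_self_add
          calc 2 * E + ENNReal.ofReal (18 * Lφ ^ 2) * I₁ ≤ 2 * E + E := add_le_add le_rfl h36
            _ = 3 * E := by ring
  -- the embedding
  have hEmb := parabolicEmbedding_of_contDiff ν gs E W ((10 : ℝ) / 3) ((10 : ℝ) / 3) 1 hgsC1 hgs2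
    hM hWm hWle (by norm_num) (by norm_num) (by norm_num) (by norm_num) le_rfl
  have hνprod' : ν.prod (volume : Measure (EuclideanSpace ℝ (Fin 3))) = volume.restrict Qu := by
    rw [hν, hQu, Measure.restrict_prod_eq_prod_univ, ← Measure.volume_eq_prod]
  have hT_eq : T = ∫⁻ s, (∫⁻ x, ‖gs s x‖ₑ ^ ((10 : ℝ) / 3)) ∂ν := by
    have e1 : T = ∫⁻ z in Qu, ‖w z‖ₑ ^ ((10 : ℝ) / 3) := by
      refine lintegral_congr fun z => ?_
      rw [Real.enorm_eq_ofReal (hw0 z), ENNReal.ofReal_rpow_of_nonneg (hw0 z) (by norm_num)]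
    rw [e1, ← hνprod', lintegral_prod _ (hwm.enorm.pow_const _).aemeasurable]
  have hT_le : T ≤ 3 * CS ^ 2 * E ^ ((5 : ℝ) / 3) := by
    have h1 : ∫⁻ s, (∫⁻ x, ‖gs s x‖ₑ ^ ((10 : ℝ) / 3)) ∂ν ≤
        E ^ ((2 : ℝ) / 3) * (CS ^ 2 * ∫⁻ s, W s ∂ν) := by
      have e : (fun s => (∫⁻ x, ‖gs s x‖ₑ ^ ((10 : ℝ) / 3)) ^ (((10 : ℝ) / 3) / ((10 : ℝ) / 3))) =
          fun s => (∫⁻ x, ‖gs s x‖ₑ ^ ((10 : ℝ) / 3)) := by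
        funext s
        rw [div_self (by norm_num), ENNReal.rpow_one]
      rw [e] at hEmb
      refine hEmb.trans (le_of_eq ?_)
      rw [show ((10 : ℝ) / 3) / 2 - 1 = (2 : ℝ) / 3 by norm_num, sub_self, ENNReal.rpow_zero,
        mul_one, ENNReal.rpow_one]
    rw [hT_eq]
    calc ∫⁻ s, (∫⁻ x, ‖gs s x‖ₑ ^ ((10 : ℝ) / 3)) ∂ν
        ≤ E ^ ((2 : ℝ) / 3) * (CS ^ 2 * ∫⁻ s, W s ∂ν) := h1
      _ ≤ E ^ ((2 : ℝ) / 3) * (CS ^ 2 * (3 * E)) := by gcongr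
      _ = 3 * CS ^ 2 * (E ^ ((2 : ℝ) / 3) * E ^ (1 : ℝ)) := by rw [ENNReal.rpow_one]; ring
      _ = 3 * CS ^ 2 * E ^ ((5 : ℝ) / 3) := by
          rw [← ENNReal.rpow_add_of_nonneg _ _ (by norm_num) (by norm_num)]; norm_num
  exact ⟨hTfin, hT_le⟩

end Summit.NavierStokesRegularity.NavierStokesRegularity.Theorems.AxisymmetricKatoGlobal.EulerScaling

end
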